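import Mathlib
import HarnessLib
import Literature.Computability.AlgebraicComplexity.PatternExpressions
import Summits.ValiantsHypothesis.ValiantsHypothesis.Theorems.MonotoneRestorationOrbitCompressionQPMultiRowStratum
import Summits.ValiantsHypothesis.ValiantsHypothesis.Theorems.MonotoneRestorationOrbitCompressionQPOneRowGadget

/-!
# Route MonotoneRestoration — aside `OrbitCompressionQP` (stmt-ValiantsHypothesis-18332), line
# `expression_compression`: the `k`-ROW COLUMN-GADGET STRATUM (master `k`-row gadget theorem)

The `k`-row stratum of `stub_narrowExpressionCompression` is the class of matrix-symmetric families
`f_n = Σ_{ρ : [k] → [n]} g_n(rows ρ(0), …, ρ(k-1))` with `g_n ∈ ℂ[x_{a,v} : a < k, v < n]^{S_n}` (`S_n` on the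
columns `v`).  For `k = 1` it is PROVED (`narrowQP_oneRow`, Bläser–Jindal); for `k ≥ 2` it is open and reduces
(`…MultiRowSocket.lean`) to a vector-symmetric Bläser–Jindal representation theorem that is not in print.
This file proves the stratum for the COLUMN-SEPARABLE `g_n`, for every `k`:

  `g_n(X) = h_n(u_n(ρ, 0), …, u_n(ρ, n-1))`, `h_n ∈ ℂ[y_0, …, y_{n-1}]^{S_n}` a symmetric `VQP` family,
  `u_n(ρ, j)` the value of ONE `(k,1)`-label pattern expression `U_n` of quasi-polynomial length (a
  polynomial of the `k` pinned rows and the pinned column `j`, e.g. the column product `Π_a x_{ρ a, j}`, a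
  column monomial `Π_a x_{ρ a, j}^{α_a}`, `x_{ρ 0, j} + x_{ρ 1, j}²`, … — anything one expression computes).

* `exists_columnGadgetPowerSum` — `Σ_j u_n(ρ, j)^b` as a `(k,1)`-expression with the `k` row labels OPEN;
* ★★ `narrowQP_multiRow_columnGadget` — **master `k`-row gadget theorem**:
  `f_n = Σ_{ρ : [k] → [n]} h_n(u_n(ρ, 0), …, u_n(ρ, n-1))` satisfies the conclusion of
  `stub_narrowExpressionCompression` with `(k, 1)` labels (Newton substituends with open labels → symmetric
  cores `VQP` by Bläser–Jindal → `VQP` substitution principle → sum out the `k` row labels → normalise);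
  `k = 1` is `narrowQP_oneRow_entryGadget`;
* `narrowQP_multiRow_columnMonomial` — the example `u_n(ρ, j) = Π_a x_{ρ a, j}^{α_a}` for a fixed
  `α ∈ ℕ^k`: `Σ_{i_0, …, i_{k-1}} h_n((x_{i_0 j}^{α_0} ⋯ x_{i_{k-1} j}^{α_{k-1}})_j)`, e.g. for `k = 2`, `α = (1,1)`,
  `h = e_n`: `Σ_{i,i'} Π_j x_{ij} x_{i'j}`;
* `multiRow_columnMonomial_matrixSymmetric` — these families are matrix-symmetric (in the stub's scope).

What it shows for the first open case: inside the `k`-row stratum the open representation problem concerns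
only the `g_n` that are NOT a symmetric function of one column gadget — the coupling between columns must
go through more than the multiset `{u_n(ρ, j)}_j`.

Helper file (`--supports stmt-ValiantsHypothesis-18332`); def-free; nothing here is a named fact; no registered
stub is closed; VP ≠ VNP is not moved.
-/

noncomputable section

open MvPolynomial

-- `Summit.ValiantsHypothesis.ValiantsHypothesis.…` is the tree's single-conjunct layout (Sub = Summit).
set_option linter.dupNamespace false

namespace Summit.ValiantsHypothesis.ValiantsHypothesis.Theorems

namespace FormulaSubstitution

open Literature.Computability.AlgebraicComplexity

section SingleLevel

variable {F : Type} [CommSemiring F] {k : ℕ}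

/-- **Power sums of a column gadget along the pinned rows**: if the value of `U` at `(ρ, γ)` is
`u ρ (γ 0)`, then `sumCol 0 (U^b)` has value `Σ_j (u ρ j)^b` (the `k` row labels open, the column label
idle) and length `b (|U| + 1) + 2`. [folklore] -/
theorem exists_columnGadgetPowerSum {n : ℕ} (U : PatternExpr F k 1)
    (u : (Fin k → Fin n) → Fin n → MvPolynomial (Fin n × Fin n) F)
    (hU : ∀ (ρ : Fin k → Fin n) (γ : Fin 1 → Fin n), U.value n ρ γ = u ρ (γ 0)) (b : ℕ) :
    ∃ q : PatternExpr F k 1, q.length = b * (U.length + 1) + 2 ∧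
      ∀ (ρ : Fin k → Fin n) (γ : Fin 1 → Fin n), q.value n ρ γ = ∑ j : Fin n, (u ρ j) ^ b := by
  obtain ⟨q, hl, hv⟩ := exists_pow U b
  refine ⟨PatternExpr.sumCol 0 q, by simp [PatternExpr.length, hl], fun ρ γ => ?_⟩
  simp only [PatternExpr.value_sumCol, hv, hU, Function.update_self]

/-- **Column monomial gadget**: `Π_a x_{ρ a, γ 0}^{α_a}` is the value of a `(k,1)`-expression of length
`≤ 2|α| + 2k + 1`. [folklore] -/
theorem exists_columnMonomial (α : Fin k → ℕ) :
    ∃ e : PatternExpr F k 1, e.length ≤ 2 * (∑ a, α a) + 2 * k + 1 ∧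
      ∀ (n : ℕ) (ρ : Fin k → Fin n) (γ : Fin 1 → Fin n),
        e.value n ρ γ = ∏ a : Fin k, X (ρ a, γ 0) ^ α a := by
  obtain ⟨e, hl, hv⟩ := exists_monomial_edges_finset (F := F) α Finset.univ
  refine ⟨e, ?_, fun n ρ γ => hv n ρ γ⟩
  have : ∑ a : Fin k, (2 * α a + 2) = 2 * ∑ a, α a + 2 * k := by
    rw [Finset.sum_add_distrib, Finset.mul_sum]; simp [mul_comm]
  omega

end SingleLevel

section Strata

/-- ★★ **Master `k`-row gadget theorem.**  For every `k`, every `VQP` family of symmetric polynomials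
`h_n ∈ ℂ[y_0, …, y_{n-1}]` and `(k,1)`-label column gadgets `U_n` of quasi-polynomial length with values
`u_n(ρ, γ 0)`, the family `f_n = Σ_{ρ : [k] → [n]} h_n(u_n(ρ, 0), …, u_n(ρ, n-1))` satisfies the conclusion
of `stub_narrowExpressionCompression` (with `(k,1)` labels). [cite: BlaserJindal2019, Thm. 4] -/
theorem narrowQP_multiRow_columnGadget (k : ℕ) (h : (n : ℕ) → MvPolynomial (Fin n) ℂ)
    (hsymm : ∀ n, (h n).IsSymmetric) (hh : IsVQPFamily h)
    (U : ℕ → PatternExpr ℂ k 1)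
    (u : (n : ℕ) → (Fin k → Fin n) → Fin n → MvPolynomial (Fin n × Fin n) ℂ)
    (hU : ∃ c : ℕ, ∀ n : ℕ, 1 ≤ n → (U n).length ≤ 2 ^ ((Nat.log 2 n + c) ^ c) ∧
      ∀ (ρ : Fin k → Fin n) (γ : Fin 1 → Fin n), (U n).value n ρ γ = u n ρ (γ 0)) :
    ∃ c : ℕ, ∀ n : ℕ, 1 ≤ n → ∃ (k' l : ℕ) (e : PatternExpr ℂ k' l),
      n ^ (k' + l) ≤ 2 ^ ((Nat.log 2 n + c) ^ c) ∧ e.length ≤ 2 ^ ((Nat.log 2 n + c) ^ c) ∧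
      e.close n = ∑ ρ : Fin k → Fin n, aeval (u n ρ) (h n) := by
  classical
  choose P hP using fun n => exists_symmetricCore (h n) (hsymm n)
  have hPq : IsVQPFamily P := isVQPFamily_symmetricCore h P hP hh
  obtain ⟨a, ha⟩ := hU
  -- Newton substituends `e_j(u_n(ρ, ·))` with the row labels open, for `n ≥ 1`
  have hsub : ∀ n : ℕ, ∃ E : ℕ → PatternExpr ℂ k 1, 1 ≤ n → ∀ j : ℕ, j ≤ n →
      (E j).length ≤ (2 * (n + 1) + 2) ^ (Nat.log 2 n + 1) *
        ((n * ((U n).length + 1) + 2) + 2 + (n + 1) + 1) ∧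
      ∀ (ρ : Fin k → Fin n) (γ : Fin 1 → Fin n),
        (E j).value n ρ γ = aeval (u n ρ) (esymm (Fin n) ℂ j) := by
    intro n
    by_cases hn : 1 ≤ n
    swap
    · exact ⟨fun _ => PatternExpr.const 0, fun h1 => absurd h1 hn⟩
    choose pw hpwl hpwv using fun b : ℕ => exists_columnGadgetPowerSum (U n) (u n) (ha n hn).2 b
    obtain ⟨E, hE⟩ := exists_esymm_subst (ι := Fin n) (k := k) (l := 1) n n (n * ((U n).length + 1) + 2)
      (fun j ρ _ => u n ρ j) pw fun b hb => ⟨by rw [hpwl]; nlinarith, fun ρ γ => hpwv b ρ γ⟩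
    exact ⟨E, fun _ j hj => hE j hj⟩
  choose E hE using hsub
  have hθ : ∃ c : ℕ, ∀ n : ℕ, 1 ≤ n → ∀ j : Fin n,
      (E n (j.val + 1)).length ≤ 2 ^ ((Nat.log 2 n + c) ^ c) := by
    obtain ⟨c, hc⟩ := gadget_esymm_length_qp a
    exact ⟨c, fun n hn j => ((hE n hn (j.val + 1) (by omega)).1).trans (hc n _ hn (ha n hn).1)⟩
  obtain ⟨c₁, hc₁⟩ := exists_narrow_subst_of_isVQPFamily (m := fun n => n) P hPq
    (k := fun _ => k) (l := fun _ => 1) (fun n j => E n (j.val + 1)) hθ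
  obtain ⟨c₂, hc₂⟩ := NarrowClosure.qp_combine c₁ (k + 1)
  refine ⟨max c₂ (k + 2), fun n hn => ?_⟩
  obtain ⟨e, hl, hv⟩ := hc₁ n hn
  set G : (Fin k → Fin n) → MvPolynomial (Fin n × Fin n) ℂ := fun ρ => aeval (u n ρ) (h n) with hG
  have hval : ∀ (ρ : Fin k → Fin n) (γ : Fin 1 → Fin n), e.value n ρ γ = G ρ := by
    intro ρ γ
    have hfun : (fun j : Fin n => (E n (j.val + 1)).value n ρ γ) =
        fun j : Fin n => aeval (u n ρ) (esymm (Fin n) ℂ (j.val + 1)) := by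
      funext j
      rw [(hE n hn (j.val + 1) (by omega)).2]
    rw [hv, hfun]
    show _ = aeval (u n ρ) (h n)
    rw [← hP n, ← AlgHom.comp_apply, comp_aeval]
  obtain ⟨e₁, hl₁, hv₁⟩ := exists_sumRows e G hval
  obtain ⟨e₂, hl₂, hc₂'⟩ := exists_close_eq_of_value_const_kl hn e₁ _ hv₁
  refine ⟨k, 1, e₂, ?_, ?_, hc₂'⟩
  · calc n ^ (k + 1) ≤ n ^ (k + 1) + (k + 1) := Nat.le_add_right _ _
      _ ≤ 2 ^ ((Nat.log 2 n + (k + 2)) ^ (k + 2)) := CompressionFloors.pbounded_le_qp n (k + 1)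
      _ ≤ 2 ^ ((Nat.log 2 n + max c₂ (k + 2)) ^ max c₂ (k + 2)) :=
          Nat.pow_le_pow_right (by norm_num) (CompressionFloors.polylog_mono (le_max_right _ _))
  · have hk : n ^ k + k ≤ 2 ^ ((Nat.log 2 n + (k + 1)) ^ (k + 1)) := CompressionFloors.pbounded_le_qp n k
    have h2 := hc₂ (Nat.log 2 n) e.length (n ^ k + k) hl hk
    have hk1 : k ≤ n ^ k + k := Nat.le_add_left _ _
    calc e₂.length = e.length + k + 2 := by rw [hl₂, hl₁]
      _ ≤ (e.length + 2) * (n ^ k + k + 2) := by nlinarith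
      _ ≤ 2 ^ ((Nat.log 2 n + c₂) ^ c₂) := h2
      _ ≤ 2 ^ ((Nat.log 2 n + max c₂ (k + 2)) ^ max c₂ (k + 2)) :=
          Nat.pow_le_pow_right (by norm_num) (CompressionFloors.polylog_mono (le_max_left _ _))

/-- **Example: symmetric `VQP` functions of column monomials.**  For every `k`, every fixed `α ∈ ℕ^k` and every
`VQP` family of symmetric `h_n`, the family `Σ_{ρ : [k] → [n]} h_n((Π_a x_{ρ a, j}^{α_a})_{j < n})` is narrow of
quasi-polynomial length — e.g. `Σ_{i,i'} Π_j x_{ij} x_{i'j}` (`k = 2`, `α = (1,1)`, `h = e_n`) or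
`Σ_{i,i'} Π_j (1 + x_{ij} x_{i'j}²)`. [cite: BlaserJindal2019, Thm. 4] -/
theorem narrowQP_multiRow_columnMonomial (k : ℕ) (α : Fin k → ℕ) (h : (n : ℕ) → MvPolynomial (Fin n) ℂ)
    (hsymm : ∀ n, (h n).IsSymmetric) (hh : IsVQPFamily h) :
    ∃ c : ℕ, ∀ n : ℕ, 1 ≤ n → ∃ (k' l : ℕ) (e : PatternExpr ℂ k' l),
      n ^ (k' + l) ≤ 2 ^ ((Nat.log 2 n + c) ^ c) ∧ e.length ≤ 2 ^ ((Nat.log 2 n + c) ^ c) ∧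
      e.close n = ∑ ρ : Fin k → Fin n, aeval (fun j : Fin n =>
        ∏ a : Fin k, (X (ρ a, j) : MvPolynomial (Fin n × Fin n) ℂ) ^ α a) (h n) := by
  obtain ⟨U, hUl, hUv⟩ := exists_columnMonomial (F := ℂ) α
  refine narrowQP_multiRow_columnGadget k h hsymm hh (fun _ => U)
    (fun n ρ j => ∏ a : Fin k, (X (ρ a, j) : MvPolynomial (Fin n × Fin n) ℂ) ^ α a)
    ⟨2 * (∑ a, α a) + 2 * k + 1, fun n _ => ⟨?_, fun ρ γ => hUv n ρ γ⟩⟩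
  set B : ℕ := 2 * (∑ a, α a) + 2 * k + 1 with hB
  have h1 : B ≤ 2 ^ B := (Nat.lt_two_pow_self).le
  have h2 : B ≤ (Nat.log 2 n + B) ^ B := by
    rcases Nat.eq_zero_or_pos B with hB0 | hBpos
    · omega
    · calc B ≤ Nat.log 2 n + B := Nat.le_add_left _ _
        _ = (Nat.log 2 n + B) ^ 1 := (pow_one _).symm
        _ ≤ (Nat.log 2 n + B) ^ B := Nat.pow_le_pow_right (by omega) hBpos
  exact hUl.trans (h1.trans (Nat.pow_le_pow_right (by norm_num) h2))

/-- **The column-monomial families are matrix-symmetric** (so they lie in the scope of the stub): row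
permutations re-index `ρ`, column permutations are absorbed by the symmetry of `h_n`. [folklore] -/
theorem multiRow_columnMonomial_matrixSymmetric {k n : ℕ} (α : Fin k → ℕ) (h : MvPolynomial (Fin n) ℂ)
    (hsymm : h.IsSymmetric) (σ τ : Equiv.Perm (Fin n)) :
    rename (fun p : Fin n × Fin n => (σ p.1, τ p.2))
      (∑ ρ : Fin k → Fin n, aeval (fun j : Fin n =>
        ∏ a : Fin k, (X (ρ a, j) : MvPolynomial (Fin n × Fin n) ℂ) ^ α a) h) =
      ∑ ρ : Fin k → Fin n, aeval (fun j : Fin n =>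
        ∏ a : Fin k, (X (ρ a, j) : MvPolynomial (Fin n × Fin n) ℂ) ^ α a) h := by
  classical
  rw [map_sum]
  have hterm : ∀ ρ : Fin k → Fin n, rename (fun p : Fin n × Fin n => (σ p.1, τ p.2))
      (aeval (fun j : Fin n =>
        ∏ a : Fin k, (X (ρ a, j) : MvPolynomial (Fin n × Fin n) ℂ) ^ α a) h) =
      aeval (fun j : Fin n =>
        ∏ a : Fin k, (X ((σ ∘ ρ) a, j) : MvPolynomial (Fin n × Fin n) ℂ) ^ α a) h := by
    intro ρ
    rw [← AlgHom.comp_apply, comp_aeval]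
    have hfun : (fun j : Fin n => rename (fun p : Fin n × Fin n => (σ p.1, τ p.2))
        (∏ a : Fin k, (X (ρ a, j) : MvPolynomial (Fin n × Fin n) ℂ) ^ α a)) =
        (fun j : Fin n =>
          ∏ a : Fin k, (X ((σ ∘ ρ) a, j) : MvPolynomial (Fin n × Fin n) ℂ) ^ α a) ∘ τ := by
      funext j
      simp only [map_prod, map_pow, rename_X, Function.comp_apply]
    -- `aeval (v ∘ τ) h = aeval v (rename τ h) = aeval v h` by the symmetry of `h`
    rw [hfun, ← aeval_rename, hsymm τ]
  simp_rw [hterm]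
  exact Fintype.sum_equiv ((Equiv.refl (Fin k)).arrowCongr σ) _ _ fun ρ => rfl

end Strata

end FormulaSubstitution

end Summit.ValiantsHypothesis.ValiantsHypothesis.Theorems

end
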